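import Summits.QuantumFields.BalabanUV.Beta.CombChartWardEnd
import Summits.QuantumFields.BalabanUV.Beta.WardLocusCombSecondOrder
import Summits.QuantumFields.BalabanUV.Beta.ReflectionLocusCombShift
import Summits.QuantumFields.BalabanUV.Beta.RowD1JointEndSymWard

/-!
# `BalabanUV.Beta.CombChartJointEndTables` — binder row D1, RULING R-D1-g35-1 (chart (III′)), ROOT F′: **THE CHART-(III′) ROW END `D1Drift Lc (JsB12CombShSym …) Nc μ ν`
# WITH (St)(Wt)(Sd)(Sr-conj) AND (Wd) REDUCED TO an1's TABLE LETTERS** — `CombChartWardEnd.d1Drift_JsB12CombShSym_of_wardLettersParity_reflLettersRem_D1Tel_D1Rep` (F′₀) with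
# (Sd) SUPPLIED by `WardLocusCombShift.hSd_JsB12CombSh0` (from (S-V)⁰⁴ via `DshAn1.hVd_iff`), (Sr-conj) by `ReflectionLocusCombShift.hSrC_JsB12CombSh0` (from (V-r)(V-ff0)(H-r),
# contacts PINNED to `γ j · ctGenM 3 (bhK Lc + Dsh Lc)`), and (Wd) by `WardLocusCombSecondOrder.exists_kernelLaws_WcombOf_of_letters` (from (c1)′, (Sp)(Mp), (T2-W)(T2-B)(T2-M₂),
# `X₂ʷ := 0`) — the (III′) twin of `RowD1JointEndSymWard.d1Drift_JsB12Sym_of_an1Shift_wardTables_reflLetters_D1Tel_D1Rep` (gen 29), with `hcomp`∕`Wc`∕`conjDefect` GONE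
# and in their place the remainder letter (Wr-conj-rem) with `hRm0 : tadpole (GcombSh Lc j) (Rm …) = 0`

HONEST FRAMING (cell contract, verbatim): «discharging `BetaPertH` makes Bałaban's UV stability UNCONDITIONAL — a real constructive-QFT
result; it is NOT the continuum limit and NOT the Clay problem.»  HONEST DEPENDENCY: continuum YM on T⁴ ⇐ BetaPertH ∧ nine spine estimates (0/9 proved);
BetaPertH ⇐ (D1) ∧ (D4) ∧ CAP+tail; G-an2-4 gates asym, D1 and NE2/3/4.
DERIVED cell leaf ([folklore] wiring BY NAME; β sub-cell, BINDER-OWNERS row D1 OWNER `b2b-balaban-beta-an2` gen 36).  No statement of Bałaban's papers, no `[cite:]`,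
no `Prop` fact, no `def`.  DISPLAYED (every one a BINDER, all about an1's tables except the last four): (S-V)⁰⁴ `hVd04`; (c1)′ at `G′` (the LOCATED OPEN socket of P4c-W);
(Sp)(Mp); the second-order table Ward letters (T2-W)(T2-B)(T2-M₂) with their remainders' classes and parities; (V-r)(V-ff0)(H-r); `γ` with its defining equation; the
second-order reflection letter (Wr-conj-rem) of `JsB12CombSh⁰` with diagonal `X₂`, remainder `Rm` (`Loc`) and `hRm0`; `D1Tel`; `D1Rep`; `h12`∕`h126`; the window.
THIS IS THE REPAIR TRACK (RULING R-D1-g35-1 (5)): the RECORD stays ROOT M′ p303989 over `JsB12Sym`.  HONEST: composition by name; repair-track root classes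
{hW-letters, hR-letters + hRm0, D1Tel, D1Rep} 0∕4 discharged; row D1 binders 0∕4; NOT D1, NOT `BetaPertH`, NOT continuum, NOT Clay.
Provenance: β sub-cell, unit beta-an2 gen 36, 2026-08-22 (v1); over this gen's `CombChartWardEnd`, `WardLocusCombSecondOrder`, `WardLocusCombShift`, `ReflectionLocusCombShift`
and chart (II)'s helpers (`DshAn1.hVd_iff`, `WardLocusRecursiveStep.conjW_zero_zero_zero`, `RowD1JointEndSymRefl.locStencil_smul_diagK_ctGenM`) BY NAME; no existing file touched.
-/

noncomputable section

open Finset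
open scoped BigOperators
open Literature.MathematicalPhysics.QuantumFieldTheory
open Literature.MathematicalPhysics.QuantumFieldTheory.Balaban1983to89
open Literature.MathematicalPhysics.QuantumFieldTheory.Balaban1983to89.Beta
open Literature.MathematicalPhysics.QuantumFieldTheory.Balaban1983to89.Beta.VectorTailsLoc (fam kfam)
open Literature.MathematicalPhysics.QuantumFieldTheory.Balaban1983to89.Beta.VectorLegVolumeAdapter (MvE)
open ExpKernelCalculus (MKer BiLoc VertexFamily comp tr tadpole shiftK)
open PolarizationSign (reflSign WardTransversal AxisReflectionCovariant)
open KernelReflection (refK)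
open ResolventReflection (bref Φ)
open AffineAveraging (box toSite)
open AveragingContoursRooted (ctr ctrOff ctrOff_mem_box)
open OneStepResolventKernel (Fib LocStencil JetData)
open OneStepKernelFamily (KInvStep vertexOfK TbalOf flipK D1Tel D1Rep D1Drift)
open KernelWard (divV divW)
open StepJetData (mfNeg wilsonA)
open BalabanStepJetsSucc (wVH)
open SecondOrderResponse (dM)
open BalabanStepW2 (M2Of wB2)
open WilsonBiStencil (wilsonW₂)
open WilsonVertex2Sym (wsym22)
open Summit.QuantumFields.BalabanUV.Beta.TameKernelCalculus
open Summit.QuantumFields.BalabanUV.Beta.ChartConjugation (conjV conjW)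
open Summit.QuantumFields.BalabanUV.Beta.AxialDressingRooted (one_le_of_neZero axEc)
open Summit.QuantumFields.BalabanUV.Beta.AveragingWardRootedStencils (legInd)
open Summit.QuantumFields.BalabanUV.Beta.SymmetrisedStepJets (SymTables)
open Summit.QuantumFields.BalabanUV.Beta.SymShiftedSpread (bhKStepSh)
open Summit.QuantumFields.BalabanUV.Beta.BorderedHessian (sgnK bhK spr_bhK bhKStep stepScale diagK)
open Summit.QuantumFields.BalabanUV.Beta.E3ContactGenerator (ctGenM)
open Summit.QuantumFields.BalabanUV.Beta.KernelWardRelative (loc_zero comp_zero_left)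
open StepDriftWitness (comp_zero_right)
open Summit.QuantumFields.BalabanUV.Beta.KernelWardLevels (loc_diagK_smul_sum_legInd)
open Summit.QuantumFields.BalabanUV.Beta.WardLocusRecursiveStep (conjW_zero_zero_zero)
open Summit.QuantumFields.BalabanUV.Beta.VertexReflectionContact (smul_diagK)
open Summit.QuantumFields.BalabanUV.Beta.RowD1JointEndSym (locStencil_smul_diagK_ctGenM)
open Summit.QuantumFields.BalabanUV.Beta.RelInvNullShift (spr_add)
open Summit.QuantumFields.BalabanUV.Beta.DshAn1 (Dsh spr_Dsh linSym04At hVd_iff)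
open Summit.QuantumFields.BalabanUV.Beta.CombChartStepJets (GcombSh ScombOf SpureCombOf WcombOf JsComb0Of_S JsComb0Of_W JsB12CombSh0 JsB12CombSh0_eq)
open Summit.QuantumFields.BalabanUV.Beta.CombChartJointEnd (JsB12CombShSym)
open Summit.QuantumFields.BalabanUV.Beta.CombChartWardEnd (d1Drift_JsB12CombShSym_of_wardLettersParity_reflLettersRem_D1Tel_D1Rep)
open Summit.QuantumFields.BalabanUV.Beta.WardLocusCombShift (hSd_JsB12CombSh0)
open Summit.QuantumFields.BalabanUV.Beta.ReflectionLocusCombShift (hSrC_JsB12CombSh0)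
open Summit.QuantumFields.BalabanUV.Beta.WardLocusCombSecondOrder (exists_kernelLaws_WcombOf_of_letters)

namespace Summit.QuantumFields.BalabanUV.Beta.CombChartJointEndTables

variable {Lc : ℕ} [NeZero Lc]

/-- **ROW D1 — THE CHART-(III′) ROOT F′: `D1Drift Lc (JsB12CombShSym hLc N tabs cΛ cB) Nc μ ν` WITH (St)(Wt)(Sd)(Sr-conj)(Wd) REDUCED TO an1's TABLE LETTERS**
(the (III′) twin of `RowD1JointEndSymWard.d1Drift_JsB12Sym_of_an1Shift_wardTables_reflLetters_D1Tel_D1Rep`; see the module docstring for what is displayed).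
HONEST: composition by name; the letters are BINDERS; NOT D1, NOT `BetaPertH`, NOT continuum, NOT Clay. -/
theorem d1Drift_JsB12CombShSym_of_wardTables_reflLetters_D1Tel_D1Rep (hLc : Odd Lc) (hL2 : 2 ≤ Lc) (N : ℕ) (tabs : SymTables 3 Lc) (cΛ cB : ℝ)
    -- hW, first order: the (0.4) stencil Ward law of `tabs.V` ((S-V)⁰⁴)
    (hVd04 : ∀ u : Fin 4 → ℤ, divV tabs.V u = conjV (mfNeg (linSym04At (ctr 4 Lc) Lc)) (diagK (legInd (ctr 4 Lc) u)))
    -- hW, SECOND ORDER — (c1)′ at the comb-chart resolvents (LOCATED OPEN), (Sp)(Mp), the table letters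
    (hc1 : ∀ (j : ℕ) (κ : Fin 4) (u : Fin 4 → ℤ),
      dM (GcombSh Lc j) Lc (SpureCombOf tabs ((Lc : ℝ) ^ (3 + 1)) (-((Lc : ℝ) ^ (3 + 1) * (1 / 2) * (Lc : ℝ) ^ (3 + 1))) cΛ j) (tabs.M j) κ u = vertexOfK (GcombSh Lc j) Lc (ScombOf tabs ((Lc : ℝ) ^ (3 + 1)) (-((Lc : ℝ) ^ (3 + 1) * (1 / 2) * (Lc : ℝ) ^ (3 + 1))) cΛ j) κ u)
    (hSp : ∀ (j : ℕ) (κ : Fin 4) (u : Fin 4 → ℤ), trK (SpureCombOf tabs ((Lc : ℝ) ^ (3 + 1)) (-((Lc : ℝ) ^ (3 + 1) * (1 / 2) * (Lc : ℝ) ^ (3 + 1))) cΛ j κ u) = -sgnK (SpureCombOf tabs ((Lc : ℝ) ^ (3 + 1)) (-((Lc : ℝ) ^ (3 + 1) * (1 / 2) * (Lc : ℝ) ^ (3 + 1))) cΛ j κ u))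
    (hMp : ∀ (j : ℕ) (ρ : Fin 4) (w : Fin 4 → ℤ), trK (tabs.M j ρ w) = -sgnK (tabs.M j ρ w))
    (RW RW'' : (Fin 4 → ℤ) → Fin 4 → (Fin 4 → ℤ) → MKer 4 (Fib 3))
    (RB RB'' : ℕ → (Fin 4 → ℤ) → Fin 4 → (Fin 4 → ℤ) → MKer 4 (Fib 3))
    (RM : ℕ → (Fin 4 → ℤ) → Fin 4 → (Fin 4 → ℤ) → MKer 4 (Fib 3))
    (hcls0 : ∃ C δ : ℝ, 0 < δ ∧ (∀ Y, LocStencil (RW Y) C δ) ∧ (∀ Y, LocStencil (RW'' Y) C δ) ∧ (∀ Y, LocStencil (RB 0 Y) C δ) ∧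
      (∀ Y, LocStencil (RB'' 0 Y) C δ) ∧ (∀ y, VertexFamily (RM 0 y) Lc C δ))
    (hclsS : ∀ j : ℕ, ∃ C δ : ℝ, 0 < δ ∧ (∀ Y, LocStencil (RB (j + 1) Y) C δ) ∧ (∀ Y, LocStencil (RB'' (j + 1) Y) C δ) ∧
      (∀ y, VertexFamily (RM (j + 1) y) Lc C δ))
    (hRWp : ∀ Y κ u, trK (RW Y κ u) = -sgnK (RW Y κ u)) (hRW''p : ∀ Y κ u, trK (RW'' Y κ u) = -sgnK (RW'' Y κ u))
    (hRBp : ∀ j Y κ u, trK (RB j Y κ u) = -sgnK (RB j Y κ u)) (hRB''p : ∀ j Y κ u, trK (RB'' j Y κ u) = -sgnK (RB'' j Y κ u))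
    (hRMp : ∀ j y ρ' w, trK (RM j y ρ' w) = -sgnK (RM j y ρ' w))
    (hWil : ∀ (Y : Fin 4 → ℤ) (κ' : Fin 4) (u' : Fin 4 → ℤ),
      (stepScale 3 Lc 0 * (Lc : ℝ) ^ (3 + 1))⁻¹ • ∑ v ∈ box (3 + 1) Lc,
          divV (fun κ u => ((Lc : ℝ) ^ 8) • wilsonW₂ 3 ((8 * (N : ℝ) ^ 2)⁻¹ • wsym22 N) κ u κ' u') ((Lc : ℤ) • Y + toSite v) =
        comp (((Lc : ℝ) ^ (3 + 1)) • wilsonA 3 κ' u') (diagK ((1 / 2 : ℝ) • ∑ v ∈ box (3 + 1) Lc, legInd (ctr (3 + 1) Lc) ((Lc : ℤ) • Y + toSite v)))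
          - comp (diagK ((1 / 2 : ℝ) • ∑ v ∈ box (3 + 1) Lc, legInd (ctr (3 + 1) Lc) ((Lc : ℤ) • Y + toSite v))) (((Lc : ℝ) ^ (3 + 1)) • wilsonA 3 κ' u') + RW Y κ' u')
    (hWil'' : ∀ (Y : Fin 4 → ℤ) (κ : Fin 4) (u : Fin 4 → ℤ),
      (stepScale 3 Lc 0 * (Lc : ℝ) ^ (3 + 1))⁻¹ • ∑ v ∈ box (3 + 1) Lc,
          divV (fun κ' u' => ((Lc : ℝ) ^ 8) • wilsonW₂ 3 ((8 * (N : ℝ) ^ 2)⁻¹ • wsym22 N) κ u κ' u') ((Lc : ℤ) • Y + toSite v) =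
        comp (((Lc : ℝ) ^ (3 + 1)) • wilsonA 3 κ u) (diagK ((1 / 2 : ℝ) • ∑ v ∈ box (3 + 1) Lc, legInd (ctr (3 + 1) Lc) ((Lc : ℤ) • Y + toSite v)))
          - comp (diagK ((1 / 2 : ℝ) • ∑ v ∈ box (3 + 1) Lc, legInd (ctr (3 + 1) Lc) ((Lc : ℤ) • Y + toSite v))) (((Lc : ℝ) ^ (3 + 1)) • wilsonA 3 κ u) + RW'' Y κ u)
    (hBord0 : ∀ (Y : Fin 4 → ℤ) (κ' : Fin 4) (u' : Fin 4 → ℤ),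
      (stepScale 3 Lc 0 * (Lc : ℝ) ^ (3 + 1))⁻¹ • ∑ v ∈ box (3 + 1) Lc, divV (fun κ u => cB • tabs.vh₂S κ u κ' u') ((Lc : ℤ) • Y + toSite v) =
        comp ((-((Lc : ℝ) ^ (3 + 1) * (1 / 2) * (Lc : ℝ) ^ (3 + 1))) • tabs.V κ' u') (diagK ((1 / 2 : ℝ) • ∑ v ∈ box (3 + 1) Lc, legInd (ctr (3 + 1) Lc) ((Lc : ℤ) • Y + toSite v)))
          - comp (diagK ((1 / 2 : ℝ) • ∑ v ∈ box (3 + 1) Lc, legInd (ctr (3 + 1) Lc) ((Lc : ℤ) • Y + toSite v))) ((-((Lc : ℝ) ^ (3 + 1) * (1 / 2) * (Lc : ℝ) ^ (3 + 1))) • tabs.V κ' u') + RB 0 Y κ' u')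
    (hBord0'' : ∀ (Y : Fin 4 → ℤ) (κ : Fin 4) (u : Fin 4 → ℤ),
      (stepScale 3 Lc 0 * (Lc : ℝ) ^ (3 + 1))⁻¹ • ∑ v ∈ box (3 + 1) Lc, divV (fun κ' u' => cB • tabs.vh₂S κ u κ' u') ((Lc : ℤ) • Y + toSite v) =
        comp ((-((Lc : ℝ) ^ (3 + 1) * (1 / 2) * (Lc : ℝ) ^ (3 + 1))) • tabs.V κ u) (diagK ((1 / 2 : ℝ) • ∑ v ∈ box (3 + 1) Lc, legInd (ctr (3 + 1) Lc) ((Lc : ℤ) • Y + toSite v)))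
          - comp (diagK ((1 / 2 : ℝ) • ∑ v ∈ box (3 + 1) Lc, legInd (ctr (3 + 1) Lc) ((Lc : ℤ) • Y + toSite v))) ((-((Lc : ℝ) ^ (3 + 1) * (1 / 2) * (Lc : ℝ) ^ (3 + 1))) • tabs.V κ u) + RB'' 0 Y κ u)
    (hBordS : ∀ (j : ℕ) (Y : Fin 4 → ℤ) (κ' : Fin 4) (u' : Fin 4 → ℤ),
      (stepScale 3 Lc (j + 1) * (Lc : ℝ) ^ (3 + 1))⁻¹ • ∑ v ∈ box (3 + 1) Lc, divV (fun κ u => (cB * wB2 3 Lc (j + 1)) • tabs.vh₂S κ u κ' u') ((Lc : ℤ) • Y + toSite v) =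
        comp (((-((Lc : ℝ) ^ (3 + 1) * (1 / 2) * (Lc : ℝ) ^ (3 + 1))) * wVH 3 Lc (j + 1)) • tabs.V κ' u') (diagK ((1 / 2 : ℝ) • ∑ v ∈ box (3 + 1) Lc, legInd (ctr (3 + 1) Lc) ((Lc : ℤ) • Y + toSite v)))
          - comp (diagK ((1 / 2 : ℝ) • ∑ v ∈ box (3 + 1) Lc, legInd (ctr (3 + 1) Lc) ((Lc : ℤ) • Y + toSite v))) (((-((Lc : ℝ) ^ (3 + 1) * (1 / 2) * (Lc : ℝ) ^ (3 + 1))) * wVH 3 Lc (j + 1)) • tabs.V κ' u') + RB (j + 1) Y κ' u')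
    (hBordS'' : ∀ (j : ℕ) (Y : Fin 4 → ℤ) (κ : Fin 4) (u : Fin 4 → ℤ),
      (stepScale 3 Lc (j + 1) * (Lc : ℝ) ^ (3 + 1))⁻¹ • ∑ v ∈ box (3 + 1) Lc, divV (fun κ' u' => (cB * wB2 3 Lc (j + 1)) • tabs.vh₂S κ u κ' u') ((Lc : ℤ) • Y + toSite v) =
        comp (((-((Lc : ℝ) ^ (3 + 1) * (1 / 2) * (Lc : ℝ) ^ (3 + 1))) * wVH 3 Lc (j + 1)) • tabs.V κ u) (diagK ((1 / 2 : ℝ) • ∑ v ∈ box (3 + 1) Lc, legInd (ctr (3 + 1) Lc) ((Lc : ℤ) • Y + toSite v)))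
          - comp (diagK ((1 / 2 : ℝ) • ∑ v ∈ box (3 + 1) Lc, legInd (ctr (3 + 1) Lc) ((Lc : ℤ) • Y + toSite v))) (((-((Lc : ℝ) ^ (3 + 1) * (1 / 2) * (Lc : ℝ) ^ (3 + 1))) * wVH 3 Lc (j + 1)) • tabs.V κ u) + RB'' (j + 1) Y κ u)
    (hM₂ : ∀ (j : ℕ) (y : Fin 4 → ℤ) (ρ' : Fin 4) (w : Fin 4 → ℤ),
      (stepScale 3 Lc j * (Lc : ℝ) ^ (3 + 1))⁻¹ • ∑ v ∈ box (3 + 1) Lc, divV (fun κ u => M2Of 3 Lc tabs.mixFF j κ u ρ' w) ((Lc : ℤ) • y + toSite v) =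
        comp (tabs.M j ρ' w) (diagK ((1 / 2 : ℝ) • ∑ v ∈ box (3 + 1) Lc, legInd (ctr (3 + 1) Lc) ((Lc : ℤ) • y + toSite v))) - comp (diagK ((1 / 2 : ℝ) • ∑ v ∈ box (3 + 1) Lc, legInd (ctr (3 + 1) Lc) ((Lc : ℤ) • y + toSite v))) (tabs.M j ρ' w) + RM j y ρ' w)
    -- hR, first order: the tables' REFLECTION letters (V-r)(V-ff0)(H-r)
    (hVfm : ∀ (α κ' : Fin 4) (u x z : Fin 4 → ℤ) (β m : Fin 4), tabs.V κ' (bref α κ' u) x z (Sum.inl β) (Sum.inr m) =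
      (reflSign α κ' • refK (Φ (d := 3) Lc α) (tabs.V κ' u + conjV (bhK (d := 3) Lc + Dsh Lc)
        ((((Lc : ℝ) ^ 4)⁻¹) • diagK (ctGenM 3 (bhK Lc + Dsh Lc) α Lc κ' u)))) x z (Sum.inl β) (Sum.inr m))
    (hVmf : ∀ (α κ' : Fin 4) (u x z : Fin 4 → ℤ) (m β : Fin 4), tabs.V κ' (bref α κ' u) x z (Sum.inr m) (Sum.inl β) =
      (reflSign α κ' • refK (Φ (d := 3) Lc α) (tabs.V κ' u + conjV (bhK (d := 3) Lc + Dsh Lc)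
        ((((Lc : ℝ) ^ 4)⁻¹) • diagK (ctGenM 3 (bhK Lc + Dsh Lc) α Lc κ' u)))) x z (Sum.inr m) (Sum.inl β))
    (hVmm : ∀ (α κ' : Fin 4) (u x z : Fin 4 → ℤ) (m m' : Fin 4), tabs.V κ' (bref α κ' u) x z (Sum.inr m) (Sum.inr m') =
      (reflSign α κ' • refK (Φ (d := 3) Lc α) (tabs.V κ' u + conjV (bhK (d := 3) Lc + Dsh Lc)
        ((((Lc : ℝ) ^ 4)⁻¹) • diagK (ctGenM 3 (bhK Lc + Dsh Lc) α Lc κ' u)))) x z (Sum.inr m) (Sum.inr m'))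
    (hV0 : ∀ (κ : Fin 4) (w x z : Fin 4 → ℤ) (β β' : Fin 4), tabs.V κ w x z (Sum.inl β) (Sum.inl β') = 0)
    (hHr : ∀ (α μ : Fin 4) (y : Fin 4 → ℤ), tabs.H μ (bref α μ y) = reflSign α μ • refK (Φ (d := 3) Lc α) (tabs.H μ y))
    -- the first-order contact coefficient, displayed
    (γ : ℕ → ℝ) (hγ : ∀ j, γ j = -((Lc : ℝ) ^ 8 / 2) * wVH 3 Lc j / (stepScale 3 Lc j * (Lc : ℝ) ^ 4))
    -- hR, second order: the reflection letter (Wr-conj-rem) of the undressed comb-chart jets with the PINNED first-order contacts, diagonal `X₂`, tadpole-null remainder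
    (x₂ : ℕ → Fin 4 → Fin 4 → (Fin 4 → ℤ) → Fin 4 → (Fin 4 → ℤ) → (Fin 4 → ℤ) → Fib 3 → ℝ)
    (hX₂ : ∀ j α μ y ν y', Loc (diagK (x₂ j α μ y ν y')))
    (Rm : ℕ → Fin 4 → Fin 4 → (Fin 4 → ℤ) → Fin 4 → (Fin 4 → ℤ) → MKer 4 (Fib 3))
    (hRmL : ∀ j α μ y ν y', Loc (Rm j α μ y ν y'))
    (hRm0 : ∀ j α μ y ν y', tadpole (GcombSh Lc j) (Rm j α μ y ν y') = 0)
    (hWrC : ∀ (j : ℕ) (α μ : Fin 4) (y : Fin 4 → ℤ) (ν : Fin 4) (y' : Fin 4 → ℤ),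
      (JsB12CombSh0 hLc N tabs cΛ cB j).W μ (bref α μ y) ν (bref α ν y') = (reflSign α μ * reflSign α ν) • refK (Φ Lc α)
        ((JsB12CombSh0 hLc N tabs cΛ cB j).W μ y ν y' +
          conjW (bhKStepSh 3 Lc (Dsh Lc) j) (vertexOfK (GcombSh Lc j) Lc (JsB12CombSh0 hLc N tabs cΛ cB j).S μ y)
            (vertexOfK (GcombSh Lc j) Lc (JsB12CombSh0 hLc N tabs cΛ cB j).S ν y')
            (vertexOfK (GcombSh Lc j) Lc (fun κ u => diagK (fun p a => γ j * ctGenM 3 (bhK Lc + Dsh Lc) α Lc κ u p a)) μ y)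
            (vertexOfK (GcombSh Lc j) Lc (fun κ u => diagK (fun p a => γ j * ctGenM 3 (bhK Lc + Dsh Lc) α Lc κ u p a)) ν y')
            (diagK (x₂ j α μ y ν y')) + Rm j α μ y ν y'))
    -- the route theorem's own binders, verbatim
    (a : ℝ) (ha : 0 < a)
    (h12 : B5.Prop12Printed (fam (fun i : ℕ+ × ℕ => ((i.1 : ℕ+) : ℕ)) (fun i => i.1.pos) MvE a ha))
    (h126 : B5.Kernel126_127Printed (kfam (fun i : ℕ+ × ℕ => ((i.1 : ℕ+) : ℕ)) MvE))
    {L : Type*} {SL : Finset L} (hSL : SL.Nonempty) (k : L → Fin 4) {μ ν : Fin 4} (hμν : μ ≠ ν) {Nc : ℝ} (hNc : Nc ≠ 0)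
    (Jc : ∀ m : ℕ, JetData 3 (Lc ^ m))
    (htel : D1Tel Lc (JsB12CombShSym hLc N tabs cΛ cB) Jc)
    {cc : ℝ} {Mw' : ℕ → ℕ} (hc : 1 ≤ cc) (hMwin : ∀ L : ℕ, 2 ≤ L → 1 ≤ Mw' L ∧ (L : ℝ) ≤ cc * Mw' L) (hML : ∀ L : ℕ, 2 ≤ L → Mw' L ≤ L)
    (hrep : D1Rep Lc Jc Nc μ ν a SL k) :
    D1Drift Lc (JsB12CombShSym hLc N tabs cΛ cB) Nc μ ν := by
  have hLc1 : 1 ≤ Lc := one_le_of_neZero Lc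
  have hVd := (hVd_iff Lc (divV tabs.V)).2 hVd04
  have hcE₂ : ((Lc : ℝ) ^ 8) = (Lc : ℝ) ^ (2 * (3 + 1)) := by norm_num
  -- (Wd): the second-order Ward kernel law of the literal's W-tables from the table letters
  obtain ⟨Nr, hcls, hpar, hlaw⟩ := exists_kernelLaws_WcombOf_of_letters (d := 3) tabs hVd cΛ cB hcE₂ ((8 * (N : ℝ) ^ 2)⁻¹ • wsym22 N) hc1 hSp hMp hcls0 hclsS
    hRWp hRW''p hRBp hRB''p hRMp hWil hWil'' hBord0 hBord0'' hBordS hBordS'' hM₂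
  have epin : -((Lc : ℝ) ^ (3 + 1) * (1 / 2) * (Lc : ℝ) ^ (3 + 1)) = -((Lc : ℝ) ^ 8 / 2) := by ring
  have hWd : ∀ (j : ℕ) (y : Fin 4 → ℤ) (ν : Fin 4) (y' : Fin 4 → ℤ),
      divW (JsB12CombSh0 hLc N tabs cΛ cB j).W y ν y' =
        conjW (bhKStepSh 3 Lc (Dsh Lc) j) 0 (vertexOfK (GcombSh Lc j) Lc (JsB12CombSh0 hLc N tabs cΛ cB j).S ν y')
          (diagK ((1 / 2 : ℝ) • ∑ v ∈ box 4 Lc, legInd (ctr 4 Lc) ((Lc : ℤ) • y + toSite v))) 0 0 + Nr j y ν y' := by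
    intro j y ν y'
    have h1 := hlaw j y ν y'
    rw [hc1 j ν y', epin] at h1
    rw [conjW_zero_zero_zero, JsB12CombSh0_eq, JsComb0Of_W, JsComb0Of_S]
    exact h1
  have hEX₂ : ∀ (j : ℕ) (y : Fin 4 → ℤ) (ν : Fin 4) (y' : Fin 4 → ℤ),
      comp (axEc (ctr 4 Lc) Lc) (0 : MKer 4 (Fib 3)) = comp (0 : MKer 4 (Fib 3)) (axEc (ctr 4 Lc) Lc) := by
    intro j y ν y'
    rw [comp_zero_left, comp_zero_right]
  -- (Sr-conj): the first-order reflection letter from the table letters, contacts pinned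
  obtain ⟨δB, CB, hδB, -, hBd⟩ := E3GenericReflection.Spr.decays' (spr_add (spr_bhK (d := 3) hLc1) (spr_Dsh hLc1))
  have hSrC : ∀ (j : ℕ) (α κ' : Fin 4) (u : Fin 4 → ℤ),
      (JsB12CombSh0 hLc N tabs cΛ cB j).S κ' (bref α κ' u) =
        reflSign α κ' • refK (Φ Lc α) ((JsB12CombSh0 hLc N tabs cΛ cB j).S κ' u +
          conjV (bhKStepSh 3 Lc (Dsh Lc) j) (diagK (fun p a => γ j * ctGenM 3 (bhK Lc + Dsh Lc) α Lc κ' u p a))) := fun j α κ' u => by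
    rw [← smul_diagK, hγ]
    exact hSrC_JsB12CombSh0 hLc N tabs cΛ cB (hVfm α) (hVmf α) (hVmm α) hV0 hHr j κ' u
  have hC : ∀ (j : ℕ) (α : Fin 4), LocStencil (fun κ u => diagK (fun p a => γ j * ctGenM 3 (bhK Lc + Dsh Lc) α Lc κ u p a))
      (|γ j| * (1 + ((Lc : ℝ) ^ (3 + 1))⁻¹ * CB)) (δB / 2) := fun j α => by
    have h := locStencil_smul_diagK_ctGenM hBd hδB.le (γ j) α Lc
    simp only [smul_diagK] at h
    exact h
  exact d1Drift_JsB12CombShSym_of_wardLettersParity_reflLettersRem_D1Tel_D1Rep hLc hL2 N tabs cΛ cB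
    (fun j y => (1 / 2 : ℝ) • ∑ v ∈ box 4 Lc, legInd (ctr 4 Lc) ((Lc : ℤ) • y + toSite v)) (fun j y => loc_diagK_smul_sum_legInd Lc _ (1 / 2 : ℝ) y)
    (fun _ _ _ _ => 0) (fun _ _ _ _ => loc_zero) hEX₂ Nr
    (fun j y ν y' => by obtain ⟨C, δ, hδ, h⟩ := hcls j; exact ⟨_, _, _, δ, hδ, h y ν y'⟩)
    (hSd_JsB12CombSh0 hLc N tabs cΛ cB hVd) hWd hpar
    (fun j α κ u => fun p a => γ j * ctGenM 3 (bhK Lc + Dsh Lc) α Lc κ u p a) (fun j => |γ j| * (1 + ((Lc : ℝ) ^ (3 + 1))⁻¹ * CB)) (fun _ => δB / 2)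
    hC (fun _ => half_pos hδB) x₂ hX₂ Rm hRmL hRm0 hSrC hWrC a ha h12 h126 hSL k hμν hNc Jc htel hc hMwin hML hrep

end Summit.QuantumFields.BalabanUV.Beta.CombChartJointEndTables

end
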